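import Literature.Probability.RandomPlanarGeometry.DrivingFunctionMeasurable
import Literature.Probability.RandomPlanarGeometry.SLERestrictionLemmas
import Literature.Probability.RandomPlanarGeometry.CritPercSLEProofs
import Literature.Probability.RandomPlanarGeometry.HullHausdorffKernel
import Literature.Probability.RandomPlanarGeometry.LoewnerCurveLimitDomain
import HarnessLib

/-!
# `stub_latticeDictionary` — the deterministic Loewner dictionary of a simple chordal curve
(crux `PathUpgradeR`, stmt-CriticalPhenomena-18055, route `SAWReversalUpgrade`, line `bidir_windows`)

Landing target:
`Summits/CriticalPhenomena/SAWScalingLimit/Theorems/SAWReversalUpgradePathUpgradeRLatticeDictionary.lean`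
(`--supports stmt-CriticalPhenomena-18055`; registered stub `stub_latticeDictionary` of
`Cruxes/PathUpgradeR/Lines/bidir_windows.lean`, statement verbatim).

**Theorem.** Let `φ : ℍ → D` be a chordal uniformizing map of the Dobrushin domain `(D; a, b)` and
`Φ` its boundary extension.

1. If `X : [0, 1] → ℂ` is a SIMPLE (injective) curve from `a` to `b` with `X t ∈ {a, b} ∪ D`, whose
   class is described through `φ` by the driving function `W` (`IsLoewnerDescribed`), then the trace
   `γ = trace W` is simple (`Loewner.IsSimpleTrace`), `closure K_T = γ[0, T]` for `T > 0`, and for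
   every `T` there is `u₀` with `X u₀ = Φ (γ T)` and `X[0, u₀] = Φ (γ[0, T])`.
2. For every `r > 0` there is `T₀` such that for every Loewner chain generated by a curve `γ`
   (continuous driving function) and every `T ≥ T₀` some `γ t`, `t ≤ T`, has `dist (Φ (γ t)) b < r`.

**Proof.** (1) The representative `c'` of the class of `X` given by the description
(`c' s = Φ (γ (s/(1-s)))`, `c' 1 = b`) is at reparametrisation distance `0` from `X`; since `X` is a
homeomorphism onto its range, `c' = X ∘ m` with `m : [0,1] → [0,1]` continuous and monotone (the
pointwise limit of the reparametrisations `ψₙ` with `‖c' - X ∘ ψₙ‖ → 0`). The factor `m` is strictly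
monotone: on an interval of constancy of `m` the curve `γ` is constant (injectivity of `Φ` on the
closed half-plane), so two hulls `K_t = K_{t'}` coincide, contradicting `hcap K_t = 2t`
(`Loewner.eq_of_hull_eq`); constancy up to `s = 1` would give `Φ (γ t) = b`, impossible. Hence
`γ` is injective, `γ t ∈ ℍ` for `t > 0` (its image `X (m s)`, `0 < m s < 1`, lies in the open set
`D`, and real points are sent to `∂D`), `K_T = γ(0, T]` (`hull_eq_image`) has closure `γ[0, T]`,
and `X[0, m s_T] = c'[0, s_T] = Φ (γ[0, T])` by the intermediate value theorem.
(2) `Φ z → b` as `z → ∞` in the closed half-plane (`tendsto_boundaryExtension_cocompact`) gives a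
radius `R`; if `γ[0, T]` stays `r`-far from `b` after `Φ` then `γ[0, T] ⊆ B̄(0, R)`, so
`K_T ⊆ B̄(0, R)` (`inter_subset_closedBall_of_diff_eq`) and `2T ≤ 288 R²`
(`Loewner.two_mul_le_of_hull_subset_closedBall`). (Lawler (2005), §4.1.) [folklore]
-/

noncomputable section

open scoped NNReal Topology unitInterval
open Filter Set Metric
open Literature.Probability.RandomPlanarGeometry
open UpperHalfPlane (upperHalfPlaneSet)

namespace Summit.CriticalPhenomena.SAWScalingLimit.Theorems

namespace PathUpgradeRLatticeDictionary

/-! ### Monotone factorisation of a representative through a simple representative -/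

/-- **Monotone factorisation.** If the curves `c` and `x` are at reparametrisation distance `0`
and `x` is injective, then `c = x ∘ m` for a continuous monotone `m : [0, 1] → [0, 1]`: `x` is a
homeomorphism onto its (common) range, `m = x⁻¹ ∘ c`, and `m` is the pointwise limit of the
increasing reparametrisations `ψₙ` with `‖c - x ∘ ψₙ‖ < 1/(n+1)`. [folklore] -/
theorem exists_monotone_comp_eq {E : Type*} [MetricSpace E] {c x : Curve E} (h : dist c x = 0)
    (hx : Function.Injective x) :
    ∃ m : I → I, Continuous m ∧ Monotone m ∧ ∀ t, c t = x (m t) := by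
  have hemb : Topology.IsClosedEmbedding x := x.continuous.isClosedEmbedding hx
  have hmem : ∀ t, ∃ u, x u = c t := fun t ↦ by
    have ht : c t ∈ x.range := by
      rw [← Curve.range_eq_of_dist_eq_zero h]
      exact Curve.mem_range.2 ⟨t, rfl⟩
    exact Curve.mem_range.1 ht
  choose m hm using hmem
  refine ⟨m, ?_, ?_, fun t ↦ (hm t).symm⟩
  · refine hemb.isInducing.continuous_iff.2 ?_
    have hcomp : (x : I → E) ∘ m = c := funext fun t ↦ hm t
    rw [hcomp]
    exact c.continuous
  · have hε : ∀ n : ℕ, dist c x < 1 / ((n : ℝ) + 1) := fun n ↦ by rw [h]; positivity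
    choose ψ hψ using fun n ↦ Curve.exists_dist_reparam_lt (hε n)
    have hclose : ∀ n (r : I), dist (c r) (x (ψ n r)) < 1 / ((n : ℝ) + 1) := fun n r ↦ by
      have h1 := ContinuousMap.dist_apply_le_dist (f := c.toContinuousMap)
        (g := (x.reparam (ψ n)).toContinuousMap) (x := r)
      simp only [Curve.coe_toContinuousMap, Curve.reparam_apply] at h1
      exact h1.trans_lt (hψ n)
    have hlim : ∀ r : I, Tendsto (fun n ↦ ψ n r) atTop (𝓝 (m r)) := fun r ↦ by
      rw [hemb.tendsto_nhds_iff]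
      have hmr : x (m r) = c r := hm r
      rw [hmr]
      refine (tendsto_const_nhds (x := c r)).congr_dist ?_
      exact squeeze_zero (fun _ ↦ dist_nonneg) (fun n ↦ (hclose n r).le)
        (tendsto_one_div_add_atTop_nhds_zero_nat (𝕜 := ℝ))
    intro s t hst
    exact le_of_tendsto_of_tendsto' (hlim s) (hlim t) fun n ↦ (ψ n).monotone hst

/-! ### The dictionary: a strictly increasing time change between `X` and the trace -/

variable {D : DobrushinDomain} {φ : ConformalEquiv upperHalfPlaneSet D.carrier}
  {X : Curve ℂ} {W : ℝ≥0 → ℝ}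

/-- **The time change.** If the class of the injective curve `X` is described through `φ` by `W`,
then the chain of `W` is generated by `γ = trace W` and there is a continuous STRICTLY increasing
`m : [0, 1] → [0, 1]`, `m 0 = 0`, `m 1 = 1`, with `X (m s) = Φ (γ (s/(1-s)))` for `s < 1`: the
monotone factor of `exists_monotone_comp_eq` is strictly monotone because an interval of
constancy before time `1` gives two equal hulls at different capacity times
(`Loewner.eq_of_hull_eq`, `hcap K_t = 2t`), and constancy up to time `1` gives `Φ (γ t) = b`
(`MarkedDomain.boundaryExtension_ne_pt_one`). [folklore] -/
theorem exists_strictMono_timeChange (hφ : D.IsChordalUniformizing φ)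
    (hXi : Function.Injective X) (hdesc : IsLoewnerDescribed φ (CurveClass.mk X) W) :
    Loewner.IsGeneratedByCurve W (Loewner.trace W) ∧
      ∃ m : I → I, Continuous m ∧ StrictMono m ∧ m 0 = 0 ∧ m 1 = 1 ∧
        ∀ s : I, (s : ℝ) < 1 → X (m s) = φ.boundaryExtension (Loewner.trace W (rayParam s)) := by
  obtain ⟨hγ, c, hc, hI⟩ := hdesc.exists_eq_mk_trace
  have hW : Continuous W := hdesc.continuous
  have hdist : dist c X = 0 := CurveClass.mk_eq_mk_iff_dist_eq_zero.1 hc.symm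
  obtain ⟨m, hmc, hmono, hcm⟩ := exists_monotone_comp_eq hdist hXi
  have hC := JordanDomain.exists_continuousOn_extension_holds
  have hinj : InjOn φ.boundaryExtension {z : ℂ | 0 ≤ z.im} :=
    JordanDomain.injOn_boundaryExtension φ
  have hval : ∀ s : I, (s : ℝ) < 1 →
      X (m s) = φ.boundaryExtension (Loewner.trace W (rayParam s)) :=
    fun s hs ↦ (hcm s).symm.trans (hI.1 s hs)
  have hm0 : m 0 = 0 := by
    refine hXi ?_
    rw [← hcm 0]
    exact Curve.source_eq_of_dist_eq_zero hdist
  have hm1 : m 1 = 1 := by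
    refine hXi ?_
    rw [← hcm 1]
    exact Curve.target_eq_of_dist_eq_zero hdist
  refine ⟨hγ, m, hmc, fun s₁ s₂ hlt ↦ (hmono hlt.le).lt_of_ne fun heq ↦ ?_, hm0, hm1, hval⟩
  have hs₁1 : (s₁ : ℝ) < 1 := lt_of_lt_of_le (Subtype.coe_lt_coe.2 hlt) s₂.2.2
  by_cases hs₂1 : (s₂ : ℝ) < 1
  · -- `γ` is constant on `[ρ s₁, ρ s₂]`, so the hulls at these two times agree
    have hconst : ∀ s : I, s₁ ≤ s → s ≤ s₂ →
        Loewner.trace W (rayParam s) = Loewner.trace W (rayParam s₁) := by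
      intro s h1s hs2
      have hms : m s = m s₁ := le_antisymm (heq ▸ hmono hs2) (hmono h1s)
      have hs1' : (s : ℝ) < 1 := lt_of_le_of_lt (Subtype.coe_le_coe.2 hs2) hs₂1
      have h3 : φ.boundaryExtension (Loewner.trace W (rayParam s)) =
          φ.boundaryExtension (Loewner.trace W (rayParam s₁)) := by
        rw [← hval s hs1', ← hval s₁ hs₁1, hms]
      exact hinj (hγ.im_nonneg _) (hγ.im_nonneg _) h3
    have hle : rayParam s₁ ≤ rayParam s₂ := (rayParam_le_rayParam_iff hs₁1 hs₂1).2 hlt.le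
    have hset : Loewner.trace W '' Icc 0 (rayParam s₂) = Loewner.trace W '' Icc 0 (rayParam s₁) := by
      refine Subset.antisymm ?_ (image_mono (Icc_subset_Icc_right hle))
      rintro _ ⟨u, hu, rfl⟩
      by_cases hu1 : u ≤ rayParam s₁
      · exact ⟨u, ⟨hu.1, hu1⟩, rfl⟩
      · obtain ⟨s, hs1, rfl⟩ := exists_rayParam_eq u
        have h1s : s₁ ≤ s := (rayParam_le_rayParam_iff hs₁1 hs1).1 (not_le.1 hu1).le
        have hs2 : s ≤ s₂ := (rayParam_le_rayParam_iff hs1 hs₂1).1 hu.2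
        exact ⟨rayParam s₁, ⟨zero_le, le_rfl⟩, (hconst s h1s hs2).symm⟩
    have hK : Loewner.hull W (rayParam s₂) = Loewner.hull W (rayParam s₁) := by
      rw [hγ.hull_eq, hγ.hull_eq, hset]
    have ht : rayParam s₂ = rayParam s₁ := Loewner.eq_of_hull_eq hW hW hK
    have hge : s₂ ≤ s₁ := (rayParam_le_rayParam_iff hs₂1 hs₁1).1 ht.le
    exact absurd hlt (not_lt.2 hge)
  · -- `s₂ = 1`: then `Φ (γ (ρ s₁)) = X (m s₁) = X (m 1) = c 1 = b`, impossible
    have hs₂eq : s₂ = 1 := Subtype.ext (le_antisymm s₂.2.2 (not_lt.1 hs₂1))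
    have h3 : X (m s₁) = D.pt 1 := by
      rw [heq, hs₂eq, ← hcm 1]
      exact hI.2
    exact MarkedDomain.boundaryExtension_ne_pt_one hC hφ (hγ.im_nonneg _)
      ((hval s₁ hs₁1).symm.trans h3)

/-- **The trace of a described simple curve is simple.** With the strictly increasing time change
`m` of `exists_strictMono_timeChange`: `γ` is injective since `X ∘ m` and `Φ` are, and for
`t = s/(1-s) > 0` the point `Φ (γ t) = X (m s)`, `0 < m s < 1`, is neither `a = X 0` nor `b = X 1`,
hence lies in the open set `D`, whose `Φ`-preimage in the closed half-plane is `ℍ` (real points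
go to `∂D`, `MarkedDomain.mem_image_boundaryExtension_iff`). [folklore] -/
theorem isSimpleTrace (hφ : D.IsChordalUniformizing φ) (hXi : Function.Injective X)
    (h0 : X.source = D.pt 0) (h1 : X.target = D.pt 1)
    (hin : ∀ t : I, X t = D.pt 0 ∨ X t = D.pt 1 ∨ X t ∈ D.carrier)
    (hdesc : IsLoewnerDescribed φ (CurveClass.mk X) W) :
    Loewner.IsSimpleTrace (Loewner.trace W) := by
  obtain ⟨hγ, m, -, hsm, hm0, hm1, hval⟩ := exists_strictMono_timeChange hφ hXi hdesc
  have hC := JordanDomain.exists_continuousOn_extension_holds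
  refine ⟨fun t t' htt' ↦ ?_, fun t ht ↦ ?_⟩
  · obtain ⟨s, hs1, rfl⟩ := exists_rayParam_eq t
    obtain ⟨s', hs'1, rfl⟩ := exists_rayParam_eq t'
    have h3 : X (m s) = X (m s') := by rw [hval s hs1, hval s' hs'1, htt']
    rw [hsm.injective (hXi h3)]
  · obtain ⟨s, hs1, rfl⟩ := exists_rayParam_eq t
    have hs0 : s ≠ 0 := by
      rintro rfl
      simp at ht
    have hspos : 0 < s := unitInterval.pos_iff_ne_zero.2 hs0
    have hslt : s < 1 := unitInterval.coe_lt_one.1 hs1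
    have hms0 : 0 < m s := by
      rw [← hm0]
      exact hsm hspos
    have hms1 : m s < 1 := by
      rw [← hm1]
      exact hsm hslt
    have h0' : X 0 = D.pt 0 := h0
    have h1' : X 1 = D.pt 1 := h1
    have hXa : X (m s) ≠ D.pt 0 := fun h ↦ hms0.ne' (hXi (h.trans h0'.symm))
    have hXb : X (m s) ≠ D.pt 1 := fun h ↦ hms1.ne (hXi (h.trans h1'.symm))
    have hXD : X (m s) ∈ D.carrier := ((hin (m s)).resolve_left hXa).resolve_left hXb
    rw [hval s hs1] at hXD
    have hS : ({Loewner.trace W (rayParam s)} : Set ℂ) ⊆ closure upperHalfPlaneSet := by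
      rintro _ rfl
      exact mem_closure_upperHalfPlaneSet_iff.2 (hγ.im_nonneg _)
    have h4 := (MarkedDomain.mem_image_boundaryExtension_iff hC hS hXD).1 ⟨_, rfl, rfl⟩
    rw [mem_singleton_iff] at h4
    have h5 : φ.symm (φ.boundaryExtension (Loewner.trace W (rayParam s))) ∈ upperHalfPlaneSet :=
      φ.symm_mapsTo hXD
    rw [h4] at h5
    exact h5

/-- **The closed hull at a positive capacity time is the initial segment of the trace**:
`closure K_T = γ[0, T]` for `T > 0`, since `K_T = γ(0, T]` for a simple trace
(`Loewner.IsGeneratedByCurve.hull_eq_image`) and `γ[0, T]` is compact. [folklore] -/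
theorem closure_hull_eq (hφ : D.IsChordalUniformizing φ) (hXi : Function.Injective X)
    (h0 : X.source = D.pt 0) (h1 : X.target = D.pt 1)
    (hin : ∀ t : I, X t = D.pt 0 ∨ X t = D.pt 1 ∨ X t ∈ D.carrier)
    (hdesc : IsLoewnerDescribed φ (CurveClass.mk X) W) {T : ℝ≥0} (hT : 0 < T) :
    closure (Loewner.hull W T) = Loewner.trace W '' Icc 0 T := by
  have hs := isSimpleTrace hφ hXi h0 h1 hin hdesc
  obtain ⟨hγ, -⟩ := hdesc.exists_eq_mk_trace
  rw [hγ.hull_eq_image hs T]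
  refine Subset.antisymm
    (closure_minimal (image_mono Ioc_subset_Icc_self)
      ((isCompact_Icc.image hγ.continuous).isClosed)) ?_
  rw [← closure_Ioc hT.ne]
  exact image_closure_subset_closure_image hγ.continuous

/-- **Initial segments correspond**: for every capacity time `T = s_T/(1-s_T)` the parameter
`u₀ = m s_T` has `X u₀ = Φ (γ T)` and `X[0, u₀] = Φ (γ[0, T])` (the time change `m` is a
continuous strictly increasing map with `m 0 = 0`, so `[0, m s_T] = m [0, s_T]` by the
intermediate value theorem, and `rayParam [0, s_T] = [0, T]`). [folklore] -/
theorem exists_image_Icc_eq (hφ : D.IsChordalUniformizing φ) (hXi : Function.Injective X)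
    (hdesc : IsLoewnerDescribed φ (CurveClass.mk X) W) (T : ℝ≥0) :
    ∃ u₀ : I, X u₀ = φ.boundaryExtension (Loewner.trace W T) ∧
      X '' Icc 0 u₀ = φ.boundaryExtension '' (Loewner.trace W '' Icc 0 T) := by
  obtain ⟨-, m, hmc, hsm, hm0, -, hval⟩ := exists_strictMono_timeChange hφ hXi hdesc
  obtain ⟨sT, hsT1, rfl⟩ := exists_rayParam_eq T
  refine ⟨m sT, hval sT hsT1, Subset.antisymm ?_ ?_⟩
  · rintro _ ⟨u, hu, rfl⟩
    obtain ⟨s, rfl⟩ : u ∈ range m := intermediate_value_univ 0 sT hmc (by rw [hm0]; exact hu)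
    have hs : s ≤ sT := hsm.le_iff_le.1 hu.2
    have hs1 : (s : ℝ) < 1 := lt_of_le_of_lt (Subtype.coe_le_coe.2 hs) hsT1
    exact ⟨Loewner.trace W (rayParam s),
      ⟨rayParam s, ⟨zero_le, (rayParam_le_rayParam_iff hs1 hsT1).2 hs⟩, rfl⟩, (hval s hs1).symm⟩
  · rintro _ ⟨_, ⟨t, ht, rfl⟩, rfl⟩
    obtain ⟨s, hs1, rfl⟩ := exists_rayParam_eq t
    have hs : s ≤ sT := (rayParam_le_rayParam_iff hs1 hsT1).1 ht.2
    exact ⟨m s, ⟨unitInterval.nonneg', hsm.monotone hs⟩, hval s hs1⟩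

/-! ### Capacity forces the curve towards `b` -/

/-- **Large capacity forces an approach of `b`.** For `r > 0` there is `T₀` such that every
Loewner chain generated by a curve `γ` with `T ≥ T₀` has a point `γ t`, `t ≤ T`, with
`dist (Φ (γ t)) b < r`: `Φ z → b` as `z → ∞` in the closed half-plane gives a radius `R` beyond
which `Φ` is `r`-close to `b`; if no `γ t`, `t ≤ T`, is close then `γ[0, T] ⊆ B̄(0, R)`, hence
`K_T ⊆ B̄(0, R)` and `2T = hcap K_T ≤ 288 R²`. [folklore] -/
theorem exists_forall_exists_dist_lt (hφ : D.IsChordalUniformizing φ) {r : ℝ} (hr : 0 < r) :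
    ∃ T₀ : ℝ≥0, ∀ (W : ℝ≥0 → ℝ) (γ : ℝ≥0 → ℂ), Continuous W → Loewner.IsGeneratedByCurve W γ →
      ∀ T : ℝ≥0, T₀ ≤ T → ∃ t : ℝ≥0, t ≤ T ∧ dist (φ.boundaryExtension (γ t)) (D.pt 1) < r := by
  have hmem : φ.boundaryExtension ⁻¹' ball (D.pt 1) r ∈ cocompact ℂ ⊓ 𝓟 {z : ℂ | 0 ≤ z.im} :=
    hφ.tendsto_boundaryExtension_cocompact (ball_mem_nhds _ hr)
  rw [mem_inf_principal] at hmem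
  obtain ⟨K, hK, hKsub⟩ := hasBasis_cocompact.mem_iff.1 hmem
  obtain ⟨R₀, hR₀⟩ := hK.isBounded.subset_closedBall 0
  set R : ℝ := max R₀ 1 with hR_def
  have hR : 0 < R := lt_of_lt_of_le one_pos (le_max_right _ _)
  have hfar : ∀ z : ℂ, 0 ≤ z.im → R < ‖z‖ → dist (φ.boundaryExtension z) (D.pt 1) < r := by
    intro z hz hRz
    have hzK : z ∈ Kᶜ := fun hzK ↦ by
      have h1 := hR₀ hzK
      rw [mem_closedBall, dist_zero_right] at h1
      exact absurd (h1.trans (le_max_left _ _)) (not_le.2 hRz)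
    exact hKsub hzK hz
  refine ⟨⟨144 * R ^ 2 + 1, by positivity⟩, fun W γ hW hγ T hT ↦ ?_⟩
  by_contra hcon
  push Not at hcon
  have hS : γ '' Icc 0 T ⊆ closedBall (0 : ℂ) R := by
    rintro _ ⟨t, ht, rfl⟩
    rw [mem_closedBall, dist_zero_right]
    by_contra hlt
    exact (hfar (γ t) (hγ.im_nonneg t) (not_le.1 hlt)).not_ge (hcon t ht.2)
  have hU : Loewner.unboundedComponent (upperHalfPlaneSet \ γ '' Icc 0 T) ⊆ upperHalfPlaneSet :=
    (Loewner.unboundedComponent_subset _).trans Set.sdiff_subset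
  have hV : upperHalfPlaneSet \ Loewner.hull W T =
      Loewner.unboundedComponent (upperHalfPlaneSet \ γ '' Icc 0 T) := by
    rw [hγ.hull_eq, Set.sdiff_sdiff_cancel_left hU]
  have hKR := inter_subset_closedBall_of_diff_eq hS hV
  have hhull : Loewner.hull W T ⊆ closedBall ((0 : ℝ) : ℂ) R := fun z hz ↦
    hKR ⟨hz, Loewner.hull_subset W T hz⟩
  have h2 := Loewner.two_mul_le_of_hull_subset_closedBall hW hR hhull
  have hT' : 144 * R ^ 2 + 1 ≤ (T : ℝ) := hT
  linarith

end PathUpgradeRLatticeDictionary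

/-- `stub_latticeDictionary` (= `LatticeDictionary`; deterministic). For a chordal uniformizing
map `φ` of `(D; a, b)` with boundary extension `Φ`: (1) a SIMPLE curve `X` from `a` to `b`,
interior in `D`, whose class is described through `φ` by `W` has a simple trace `γ = trace W`,
`closure K_T = γ[0, T]` for `T > 0`, and `X[0, u₀] = Φ (γ[0, T])` for some `u₀` with
`X u₀ = Φ (γ T)`; (2) capacity `≥ T₀(r)` forces an `r`-approach of `b`. Assembled from
`PathUpgradeRLatticeDictionary.isSimpleTrace`, `.closure_hull_eq`, `.exists_image_Icc_eq`,
`.exists_forall_exists_dist_lt`. [folklore] -/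
theorem stub_latticeDictionary : ∀ (D : Literature.Probability.RandomPlanarGeometry.DobrushinDomain) (φ : Literature.Probability.RandomPlanarGeometry.ConformalEquiv UpperHalfPlane.upperHalfPlaneSet D.carrier), D.IsChordalUniformizing φ → (∀ (X : Literature.Probability.RandomPlanarGeometry.Curve ℂ) (W : NNReal → ℝ), Function.Injective X → X.source = D.pt 0 → X.target = D.pt 1 → (∀ t : unitInterval, X t = D.pt 0 ∨ X t = D.pt 1 ∨ X t ∈ D.carrier) → Literature.Probability.RandomPlanarGeometry.IsLoewnerDescribed φ (Literature.Probability.RandomPlanarGeometry.CurveClass.mk X) W → Literature.Probability.RandomPlanarGeometry.Loewner.IsSimpleTrace (Literature.Probability.RandomPlanarGeometry.Loewner.trace W) ∧ (∀ T : NNReal, 0 < T → closure (Literature.Probability.RandomPlanarGeometry.Loewner.hull W T) = Literature.Probability.RandomPlanarGeometry.Loewner.trace W '' Set.Icc 0 T) ∧ (∀ T : NNReal, ∃ u₀ : unitInterval, X u₀ = φ.boundaryExtension (Literature.Probability.RandomPlanarGeometry.Loewner.trace W T) ∧ X '' Set.Icc 0 u₀ = φ.boundaryExtension '' (Literature.Probability.RandomPlanarGeometry.Loewner.trace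 W '' Set.Icc 0 T))) ∧ (∀ r : ℝ, 0 < r → ∃ T₀ : NNReal, ∀ (W : NNReal → ℝ) (γ : NNReal → ℂ), Continuous W → Literature.Probability.RandomPlanarGeometry.Loewner.IsGeneratedByCurve W γ → ∀ T : NNReal, T₀ ≤ T → ∃ t : NNReal, t ≤ T ∧ dist (φ.boundaryExtension (γ t)) (D.pt 1) < r) := by
  intro D φ hφ
  refine ⟨fun X W hXi h0 h1 hin hdesc ↦ ⟨?_, ?_, ?_⟩, fun r hr ↦ ?_⟩
  · exact PathUpgradeRLatticeDictionary.isSimpleTrace hφ hXi h0 h1 hin hdesc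
  · exact fun T hT ↦ PathUpgradeRLatticeDictionary.closure_hull_eq hφ hXi h0 h1 hin hdesc hT
  · exact fun T ↦ PathUpgradeRLatticeDictionary.exists_image_Icc_eq hφ hXi hdesc T
  · exact PathUpgradeRLatticeDictionary.exists_forall_exists_dist_lt hφ hr

end Summit.CriticalPhenomena.SAWScalingLimit.Theorems

end
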